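import Summits.Ventures.PercRepro.S2CoindepNullity
import Summits.Ventures.PercRepro.RankLevelSetCountBounds
import Mathlib.Order.Interval.Finset.SuccPred

/-!
# PercRepro — S2: COUNTING THE COINDEPENDENT `m`-SETS THROUGH A SET OF NULLITY `k` (p7, gen 9; generic)

The nullity-payment inequality (S2CoindepNullity: `|B| + ν(W) ≤ ν(E) + |B ∩ W|` for every coindependent `B` and every
`W ⊆ E`) turned into a COUNT in the kit's vocabulary: on a core of nullity `d` (`|E| = ρ(E) + d`), for a set
`W ⊆ E` of nullity `k` (`|W| = ρ(W) + k`), the coindependent `m`-sets number at most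

  `Σ_{j = m + k − d}^{m} C(|W|, j) · C(|E| − |W|, m − j)`

(an `m`-subset of `E` with `j` points in `W` is a pair of a `j`-subset of `W` and an `(m − j)`-subset of `E ∖ W`).
At `(16, 7)` with a rank-`4` `10`-point `W` (`k = 6`): the coindependent sets of size `5 / 6 / 7` number at most
`C(10,4)·13 + C(10,5) = 2,982`, `C(10,5)·13 + C(10,6) = 3,486`, `C(10,6)·13 + C(10,7) = 2,850` — against the union
bound's `2 · 14,181` on the sizes `6` and `7` of that very matroid. Axioms: standard.
-/

open scoped Matroid

namespace PercRepro

namespace S2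

open Set

variable {α : Type}

/-- The `m`-subsets of a finset `E` meeting a finset `W ⊆ E` in exactly `j` points number at most
`C(|W|, j) · C(|E| − |W|, m − j)` (`X ↦ (X ∩ W, X \ W)` is injective). -/
theorem ncard_subsets_inter_eq_le (E W : Finset α) (hW : W ⊆ E) (m j : ℕ) :
    {X : Set α | X ⊆ (E : Set α) ∧ X.ncard = m ∧ (X ∩ (W : Set α)).ncard = j}.ncard ≤
      W.card.choose j * (E.card - W.card).choose (m - j) := by
  classical
  set A : Set (Set α) := {Y : Set α | Y ⊆ ((W : Finset α) : Set α) ∧ Y.ncard = j} with hA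
  set Bs : Set (Set α) := {Y : Set α | Y ⊆ ((E \ W : Finset α) : Set α) ∧ Y.ncard = m - j} with hBs
  have hAcard : A.ncard = W.card.choose j := PercRepro.ncard_subsets_ncard_eq W j
  have hBcard : Bs.ncard = (E.card - W.card).choose (m - j) := by
    rw [hBs, PercRepro.ncard_subsets_ncard_eq, Finset.card_sdiff_of_subset hW]
  have hAfin : A.Finite := (W.finite_toSet.finite_subsets).subset (fun Y hY => hY.1)
  have hBfin : Bs.Finite := ((E \ W).finite_toSet.finite_subsets).subset (fun Y hY => hY.1)
  calc {X : Set α | X ⊆ (E : Set α) ∧ X.ncard = m ∧ (X ∩ (W : Set α)).ncard = j}.ncard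
      ≤ (A ×ˢ Bs).ncard := by
        refine Set.ncard_le_ncard_of_injOn (fun X => (X ∩ (W : Set α), X \ (W : Set α))) ?_ ?_ (hAfin.prod hBfin)
        · rintro X ⟨hXE, hXm, hXj⟩
          have hXfin : X.Finite := E.finite_toSet.subset hXE
          refine Set.mem_prod.2 ⟨⟨inter_subset_right, hXj⟩, ⟨?_, ?_⟩⟩
          · show X \ (W : Set α) ⊆ ((E \ W : Finset α) : Set α)
            rw [Finset.coe_sdiff]
            exact sdiff_subset_sdiff_left hXE
          · show (X \ (W : Set α)).ncard = m - j
            have h := Set.ncard_inter_add_ncard_sdiff_eq_ncard X (W : Set α) hXfin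
            rw [hXj, hXm] at h
            omega
        · rintro X ⟨hXE, -, -⟩ Y ⟨hYE, -, -⟩ hXY
          simp only [Prod.mk.injEq] at hXY
          rw [← Set.inter_union_sdiff X (W : Set α), hXY.1, hXY.2, Set.inter_union_sdiff]
    _ = W.card.choose j * (E.card - W.card).choose (m - j) := by
        rw [Set.ncard_prod, hAcard, hBcard]

/-- The `m`-subsets of `E` with at least `j₀` points in `W ⊆ E` number at most
`Σ_{j ∈ [j₀, m]} C(|W|, j) · C(|E| − |W|, m − j)`. -/
theorem ncard_subsets_inter_ge_le (E W : Finset α) (hW : W ⊆ E) (m j₀ : ℕ) :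
    {X : Set α | X ⊆ (E : Set α) ∧ X.ncard = m ∧ j₀ ≤ (X ∩ (W : Set α)).ncard}.ncard ≤
      ∑ j ∈ Finset.Icc j₀ m, W.card.choose j * (E.card - W.card).choose (m - j) := by
  classical
  have hfinE : ∀ S : Set (Set α), S ⊆ {X : Set α | X ⊆ (E : Set α)} → S.Finite :=
    fun S hS => (E.finite_toSet.finite_subsets).subset hS
  -- downward induction on `j₀` from `m + 1` (where the family is empty)
  suffices h : ∀ t : ℕ, ∀ j₀ : ℕ, j₀ + t = m + 1 →
      {X : Set α | X ⊆ (E : Set α) ∧ X.ncard = m ∧ j₀ ≤ (X ∩ (W : Set α)).ncard}.ncard ≤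
        ∑ j ∈ Finset.Icc j₀ m, W.card.choose j * (E.card - W.card).choose (m - j) by
    rcases Nat.lt_or_ge m j₀ with hlt | hle
    · -- `j₀ > m`: the family is empty (`|X ∩ W| ≤ |X| = m < j₀`)
      have hempty : {X : Set α | X ⊆ (E : Set α) ∧ X.ncard = m ∧ j₀ ≤ (X ∩ (W : Set α)).ncard} = ∅ := by
        ext X
        simp only [mem_setOf_eq, mem_empty_iff_false, iff_false, not_and]
        intro hXE hXm hj
        have hXfin : X.Finite := E.finite_toSet.subset hXE
        have := Set.ncard_inter_le_ncard_left X (W : Set α) hXfin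
        omega
      rw [hempty, Set.ncard_empty]
      exact Nat.zero_le _
    · exact h (m + 1 - j₀) j₀ (by omega)
  intro t
  induction t with
  | zero =>
    intro j₀ hj₀
    have hempty : {X : Set α | X ⊆ (E : Set α) ∧ X.ncard = m ∧ j₀ ≤ (X ∩ (W : Set α)).ncard} = ∅ := by
      ext X
      simp only [mem_setOf_eq, mem_empty_iff_false, iff_false, not_and]
      intro hXE hXm hj
      have hXfin : X.Finite := E.finite_toSet.subset hXE
      have := Set.ncard_inter_le_ncard_left X (W : Set α) hXfin
      omega
    rw [hempty, Set.ncard_empty]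
    exact Nat.zero_le _
  | succ t ih =>
    intro j₀ hj₀
    have hsplit : {X : Set α | X ⊆ (E : Set α) ∧ X.ncard = m ∧ j₀ ≤ (X ∩ (W : Set α)).ncard} ⊆
        {X : Set α | X ⊆ (E : Set α) ∧ X.ncard = m ∧ (X ∩ (W : Set α)).ncard = j₀} ∪
          {X : Set α | X ⊆ (E : Set α) ∧ X.ncard = m ∧ j₀ + 1 ≤ (X ∩ (W : Set α)).ncard} := by
      rintro X ⟨hXE, hXm, hj⟩
      rcases Nat.lt_or_ge j₀ (X ∩ (W : Set α)).ncard with h | h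
      · exact Or.inr ⟨hXE, hXm, h⟩
      · exact Or.inl ⟨hXE, hXm, le_antisymm h hj⟩
    have hIcc : Finset.Icc j₀ m = insert j₀ (Finset.Icc (j₀ + 1) m) := by
      have h := Finset.insert_Icc_succ_left_eq_Icc (α := ℕ) (a := j₀) (b := m) (by omega)
      rw [Order.succ_eq_add_one] at h
      exact h.symm
    calc {X : Set α | X ⊆ (E : Set α) ∧ X.ncard = m ∧ j₀ ≤ (X ∩ (W : Set α)).ncard}.ncard
        ≤ ({X : Set α | X ⊆ (E : Set α) ∧ X.ncard = m ∧ (X ∩ (W : Set α)).ncard = j₀} ∪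
            {X : Set α | X ⊆ (E : Set α) ∧ X.ncard = m ∧ j₀ + 1 ≤ (X ∩ (W : Set α)).ncard}).ncard :=
          Set.ncard_le_ncard hsplit ((hfinE _ (fun X hX => hX.1)).union (hfinE _ (fun X hX => hX.1)))
      _ ≤ {X : Set α | X ⊆ (E : Set α) ∧ X.ncard = m ∧ (X ∩ (W : Set α)).ncard = j₀}.ncard +
            {X : Set α | X ⊆ (E : Set α) ∧ X.ncard = m ∧ j₀ + 1 ≤ (X ∩ (W : Set α)).ncard}.ncard :=
          Set.ncard_union_le _ _
      _ ≤ W.card.choose j₀ * (E.card - W.card).choose (m - j₀) +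
            ∑ j ∈ Finset.Icc (j₀ + 1) m, W.card.choose j * (E.card - W.card).choose (m - j) :=
          add_le_add (ncard_subsets_inter_eq_le E W hW m j₀) (ih (j₀ + 1) (by omega))
      _ = ∑ j ∈ Finset.Icc j₀ m, W.card.choose j * (E.card - W.card).choose (m - j) := by
          rw [hIcc, Finset.sum_insert (by simp)]

/-- **The coindependent `m`-sets through a set of nullity `k`** (the counting form of the nullity payment): on a
core of nullity `d` (`|E| = ρ(E) + d`), for `W ⊆ E` with `|W| = ρ(W) + k`, the sets `B ⊆ E` of size `m` whose
complement spans number at most `Σ_{j = m + k − d}^{m} C(|W|, j) · C(|E| − |W|, m − j)`. -/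
theorem ncard_spanning_compl_le_of_nullity (M : Matroid α) [M.Finite] {W : Set α} (hW : W ⊆ M.E) {d k m : ℕ}
    (hd : M.E.encard = M.eRank + d) (hk : W.encard = M.eRk W + k) :
    {B : Set α | B ⊆ M.E ∧ B.ncard = m ∧ M.eRk (M.E \ B) = M.eRank}.ncard ≤
      ∑ j ∈ Finset.Icc (m + k - d) m, W.ncard.choose j * (M.E.ncard - W.ncard).choose (m - j) := by
  classical
  have hWfin : W.Finite := M.ground_finite.subset hW
  set E' : Finset α := M.ground_finite.toFinset with hE'
  set W' : Finset α := hWfin.toFinset with hW'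
  have hE : (E' : Set α) = M.E := Set.Finite.coe_toFinset _
  have hWc : (W' : Set α) = W := Set.Finite.coe_toFinset _
  have hW'E' : W' ⊆ E' := by
    rw [← Finset.coe_subset, hE, hWc]; exact hW
  have hEcard : E'.card = M.E.ncard := (Set.ncard_eq_toFinset_card M.E M.ground_finite).symm
  have hWcard : W'.card = W.ncard := (Set.ncard_eq_toFinset_card W hWfin).symm
  have hR : M.eRank ≠ ⊤ := (_root_.Matroid.eRank_ne_top_iff M).2 inferInstance
  have hfin : M.eRk W ≠ ⊤ := ne_top_of_le_ne_top hWfin.encard_lt_top.ne (M.eRk_le_encard W)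
  have hsub : {B : Set α | B ⊆ M.E ∧ B.ncard = m ∧ M.eRk (M.E \ B) = M.eRank} ⊆
      {X : Set α | X ⊆ (E' : Set α) ∧ X.ncard = m ∧ m + k - d ≤ (X ∩ (W' : Set α)).ncard} := by
    rintro B ⟨hBE, hBm, hBs⟩
    refine ⟨by rw [hE]; exact hBE, hBm, ?_⟩
    rw [hWc]
    have h := encard_add_le_of_spanning_compl_of_nullity M hBE hW hBs hd hk hfin hR
    have hBfin : B.Finite := M.ground_finite.subset hBE
    have hWBfin : (W ∩ B).Finite := hWfin.subset inter_subset_left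
    rw [← hBfin.cast_ncard_eq, ← hWBfin.cast_ncard_eq] at h
    have h' : B.ncard + k ≤ d + (W ∩ B).ncard := by exact_mod_cast h
    rw [inter_comm]
    omega
  calc {B : Set α | B ⊆ M.E ∧ B.ncard = m ∧ M.eRk (M.E \ B) = M.eRank}.ncard
      ≤ {X : Set α | X ⊆ (E' : Set α) ∧ X.ncard = m ∧ m + k - d ≤ (X ∩ (W' : Set α)).ncard}.ncard :=
        Set.ncard_le_ncard hsub ((E'.finite_toSet.finite_subsets).subset (fun X hX => hX.1))
    _ ≤ ∑ j ∈ Finset.Icc (m + k - d) m, W'.card.choose j * (E'.card - W'.card).choose (m - j) :=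
        ncard_subsets_inter_ge_le E' W' hW'E' m (m + k - d)
    _ = ∑ j ∈ Finset.Icc (m + k - d) m, W.ncard.choose j * (M.E.ncard - W.ncard).choose (m - j) := by
        rw [hWcard, hEcard]

/-- **The `(16, 7)` instance**: on a core of nullity `7` with `23` points carrying a `10`-point set `W` of nullity `6`
(rank `4` — the K₅ shape), the coindependent sets of size `5 / 6 / 7` number at most `2982 / 3486 / 2850`. -/
theorem ncard_spanning_compl_le_sixteen_seven (M : Matroid α) [M.Finite] (hd : M.E.encard = M.eRank + 7)
    (hn : M.E.ncard = 23) {W : Set α} (hW : W ⊆ M.E) (hWn : W.ncard = 10) (hWk : W.encard = M.eRk W + 6) :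
    {B : Set α | B ⊆ M.E ∧ B.ncard = 5 ∧ M.eRk (M.E \ B) = M.eRank}.ncard ≤ 2982 ∧
      {B : Set α | B ⊆ M.E ∧ B.ncard = 6 ∧ M.eRk (M.E \ B) = M.eRank}.ncard ≤ 3486 ∧
        {B : Set α | B ⊆ M.E ∧ B.ncard = 7 ∧ M.eRk (M.E \ B) = M.eRank}.ncard ≤ 2850 := by
  refine ⟨?_, ?_, ?_⟩
  · refine (ncard_spanning_compl_le_of_nullity M hW hd hWk).trans ?_
    rw [hWn, hn]; decide
  · refine (ncard_spanning_compl_le_of_nullity M hW hd hWk).trans ?_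
    rw [hWn, hn]; decide
  · refine (ncard_spanning_compl_le_of_nullity M hW hd hWk).trans ?_
    rw [hWn, hn]; decide

end S2

end PercRepro
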